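import Summits.HodgeConjecture.HodgeConjecture.Theses.NodalThetaWeil
import Literature.AlgebraicGeometry.HodgeTheory.NodalDivisor
import Literature.AlgebraicGeometry.HodgeTheory.WeilClassesHodgeType
import Literature.AlgebraicGeometry.Motives.CartierDivisorOfIdealSheaf

/-!
# Birth skeleton (BC3) of the crux `NodalThetaSupport` (stmt-HodgeConjecture-7744),
# route `NodalThetaWeil` — line `birth`: "a Weil-visible class on a nodal theta divisor"

The crux `X1 = NodalThetaSupport` says: on an abelian SIXFOLD of Weil type `(A, φ ≫ φ = -d·𝟙)`
every rational `(3,3)`-class `c` of the Weil plane `W = E₊ ⊕ E₋ ⊆ H⁶(A(ℂ); ℂ)`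
(`weilClassesOf A φ 3 d`) lies in `N¹H⁶ = supportedClasses A.X 6 1` (geometric coniveau `≥ 1`).
Its typed form carries none of the route's mechanism ("coniveau ≥ 1 only", route review
2026-08-15); this line cuts the crux along the mechanism of the thesis (Thomas's nodal criterion
on `(A, Θ)`, Thomas2005Nodes Thm. 1, read p. 3) into

  STUB B (THE HEART, open — `NodalThetaMember ∧ ThimbleRelationW` of the route's two-layer plan,
  in the language the tree has TODAY): for every abelian sixfold of BALANCED Weil type
  (`dim (V₊ ∩ H^{1,0}) = 3`, the typing of `WeilClassesHodgeType`) there are an ample Cartier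
  divisor `Θ`, a level `k ≥ 2`, a NODAL member `ι : D ↪ A` of `|kΘ|` (`IsNodalDivisor 5 m ι`,
  `m ≥ 1` nodes, `𝒪(D) ∼ kΘ` via `CartierDivisor.ofIsEffectiveCartier`) and a class `s` SUPPORTED
  ON `D` (`s ∈ classesSupportedOn A.X (support ι) 6 = ker (H⁶(A) → H⁶(A ∖ D))`) which is
  WEIL-VISIBLE: some polynomial in one test pull-back `(x·𝟙 + y·φ)^*` (`x > 0`) moves `s` to a
  NON-ZERO element of the Weil plane — "the thimble class has non-zero W-projection, `π_W` a
  polynomial in the K-action" (route header), with vanishing spheres / thimbles replaced by their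
  only typable shadow, the supported class `s` (for nodal `D`, `classesSupportedOn = π_*ι_* H⁴(D̃)`
  and the NEW part of `H⁴(D̃)` is the node-dual lattice `⟨Aᵢ − Bᵢ⟩^*` of relations among the
  vanishing spheres: Thomas2005Nodes §3, Schoen's Lemma 1.1 = eq. (d), read p. 5);

  STUB A (K-RIGIDITY OF CONIVEAU ON THE WEIL PLANE, provable now, M–L): a Weil-visible class
  supported on ANY effective Cartier divisor forces the WHOLE Weil plane into `N¹H⁶`. Inputs, all
  in the tree: the support of an effective Cartier divisor is a proper Zariski-closed subset, so
  `classesSupportedOn ≤ N¹` (`classesSupportedOn_le_supportedClasses`,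
  `one_le_coheight_of_mem_of_isClosed`); `N¹` is stable under the pull-backs `(x·𝟙 + y·φ)^*`,
  `x > 0` — isogenies, `(x·𝟙 - y·φ)(x·𝟙 + y·φ) = [x² + dy²]` (`surjective_zsmul_id`,
  `cotangentMap_zsmul_id_holds`, `map_mem_supportedClasses_one_of_surjective`); `E₊`, `E₋` are
  LINES (`finrank_weilClassesPlus_eq_one`) separated by one test endomorphism
  (`exists_nat_separating`), so a non-zero `t ∈ N¹ ∩ W` puts `E₊` or `E₋` inside `N¹`; and
  `N¹ = span of its rational classes` (`supportedClasses_eq_span_isRationalClass`) is stable under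
  complex conjugation (`conjClass_*`, `IsRationalClass.conjClass_eq`), which swaps `E₊` and `E₋`
  (`conjClass_mem_weilClassesPlus`). Hence `W ≤ N¹`.

and the kernel-checked composition `NodalThetaSupport_of : STUB A → STUB B → NodalThetaSupport`
(real proof: `c = 0` is trivial; otherwise `c ∈ W` by `mem_weilClassesOf_iff`, `(A, φ)` is
balanced by Deligne–Milne Prop. 4.4 "only if" (`finrank_eq_of_mem_weilClassesOf`, PROVED in the
tree), STUB B hands a Weil-visible class on a nodal theta divisor, STUB A puts `W`, hence `c`, in
`N¹H⁶`).

Why the cut is honest (no costume, no shred). STUB A is strictly weaker than the crux (it needs a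
witness) and is a theorem of linear algebra + isogenies, not of Hodge theory. STUB B is the thesis
of the route in sharp form: it is STRONGER than what the composition consumes (only
`IsClosedImmersion`, `IsEffectiveCartier`, `s` supported and Weil-visible are used; ampleness,
`k ≥ 2`, `|kΘ|`-membership and NODALITY are the mechanism — they are what makes the next crux
`NodeDualClassesAlgebraic` computable through Schoen's sequence) and it is sandwiched:
HC(Weil sixfolds) ⇒ STUB B (Thomas2005Nodes §4, read p. 6: Prop. 2 + Kleiman's Thm. 5 + Thm. 6 give
a nodal `D ∈ |NΘ|` through a smoothed cycle `Z` with `[Z] = N₁w + N₂θ³`, and `π_W[Z] = N₁w ≠ 0`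
for a suitable `N₂`) and STUB B ⇒ X1 (this file). By primitivity (route support
`WeilClassesPrimitive`) no SMOOTH member and no divisor with Lefschetz-standard `H₆` can serve:
the bet is the nodes (first regime `k = 2`, Kummer tangent hyperplanes).

Disproof used: none on file (`Cruxes/NodalThetaSupport/` had no `Disproof.lean` at registration,
2026-08-17); negatives index of the summit: empty for this sector.

## Contents

* `IsWeilVisible A φ d s` — some polynomial in one test pull-back `(x·𝟙 + y·φ)^*|H⁶`, `x > 0`,
  moves `s` to a non-zero class of `weilClassesOf A φ 3 d`.
* `IsNodalThetaMember A Θ k ι` — `ι` is an `m`-nodal divisor (`m ≥ 1`) whose Cartier divisor is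
  linearly equivalent to `k • Θ`.
* `stub_weilPlane_coniveau_rigidity` (STUB A), `stub_nodalThetaMember_weilVisible` (STUB B) —
  `sorry` ONLY here.
* `NodalThetaSupport_of` — STUB A → STUB B → the crux BY NAME
  (`Summit.HodgeConjecture.HodgeConjecture.Theses.NodalThetaWeil.NodalThetaSupport`), no `sorry`;
  `NodalThetaSupport_of_stubs` — the crux modulo exactly the two stubs.
* `isWeilVisible_of_mem` — sanity: a non-zero class of the Weil plane is Weil-visible (the
  predicate is inhabited in kind; `x = 1, y = 0, p = 1`).
-/

noncomputable section

namespace Summit.HodgeConjecture.HodgeConjecture.Cruxes.NodalThetaSupport.Birth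

open CategoryTheory AlgebraicGeometry
open Literature.AlgebraicGeometry.Motives Literature.AlgebraicGeometry.HodgeTheory
  Literature.AlgebraicGeometry.Resolution Literature.AlgebraicTopology.SingularHomology
open Summit.HodgeConjecture.HodgeConjecture.Theses.NodalThetaWeil (NodalThetaSupport)

/-- The underlying scheme of a complex abelian variety is integral (geometrically integral
structure morphism). [folklore] -/
instance isIntegral_left_complex (A : AbelianVariety ℂ) : IsIntegral A.X.left :=
  SchemeOver.isIntegral_left A.X

/-! ### The two predicates of the line -/

/-- **Weil-visibility** of a class `s ∈ H⁶(A(ℂ); ℂ)` of `(A, φ)`, `φ ≫ φ = -d`: for some test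
endomorphism `ψ = x·𝟙 + y·φ` with `x > 0` (an isogeny commuting with `φ`) and some polynomial
`p`, the class `p(ψ^*) s` is a NON-ZERO element of the Weil plane `weilClassesOf A φ 3 d = E₊ ⊔ E₋`.
For a separating `x` (`exists_nat_separating`) the projector of `H⁶` onto `E₊ ⊔ E₋` along the
other characters of `ψ^*` is such a polynomial, so this says "`s` has non-zero `W`-projection"
— the route's certificate "`π_W` a polynomial in the `K`-action". [cite: vanGeemen1994HodgeAV, 4.8–4.9 and proof of Thm. 6.12] -/
def IsWeilVisible (A : AbelianVariety ℂ) (φ : A ⟶ A) (d : ℕ) (s : complexBetti A.X (2 * 3)) :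
    Prop :=
  ∃ (x y : ℕ) (p : Polynomial ℂ), 0 < x ∧
    Polynomial.aeval (complexBetti.map (x • 𝟙 A + y • φ).hom.hom.hom (2 * 3)).hom p s ∈
        weilClassesOf A φ 3 d ∧
      Polynomial.aeval (complexBetti.map (x • 𝟙 A + y • φ).hom.hom.hom (2 * 3)).hom p s ≠ 0

/-- **`ι : D ↪ A` is a nodal member of `|kΘ|`**: `ι` is an `m`-nodal divisor of dimension `5`
with at least one node (`IsNodalDivisor 5 m ι`, `1 ≤ m`: closed immersion, effective Cartier
ideal, reduced, exactly `m` singular points, all ordinary double points), and the effective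
Cartier divisor cut out by its ideal sheaf (`CartierDivisor.ofIsEffectiveCartier`) is linearly
equivalent to `k • Θ`. [cite: Thomas2005Nodes, §1 and Thm. 1] [cite: StacksProject, Tag 01WS] -/
def IsNodalThetaMember (A : AbelianVariety ℂ) (Θ : CartierDivisor A.X.left) (k : ℕ)
    {D : SchemeOver ℂ} (ι : D ⟶ A.X) : Prop :=
  ∃ m : ℕ, 1 ≤ m ∧ IsNodalDivisor 5 m ι ∧
    ∃ hI : IsEffectiveCartier ι.left.ker,
      (CartierDivisor.ofIsEffectiveCartier ι.left.ker hI).LinEquiv (k • Θ)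

/-! ### The two registered stubs -/

/-- STUB A (provable now; M–L) — **`K`-rigidity of coniveau on the Weil plane.** On an abelian
sixfold `(A, φ ≫ φ = -d·𝟙)`, if some class `s` supported on an effective Cartier divisor
`ι : D ↪ A` (`s` dies on `(A ∖ D)(ℂ)`) is Weil-visible, then the WHOLE Weil plane lies in `N¹H⁶`.
Proof sketch (all inputs in the tree): `support ι` is a proper closed subset (a local equation is a
non-zero-divisor, hence a unit at the generic point), so `s ∈ N¹`; `N¹` is stable under the isogeny
pull-backs `(x·𝟙 + y·φ)^*`, `x > 0` (`(x·𝟙 - y·φ)(x·𝟙 + y·φ) = [x² + dy²]` is onto;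
`map_mem_supportedClasses_one_of_surjective`), hence under polynomials in them, so
`t := p(ψ^*) s ∈ N¹ ∩ (E₊ ⊔ E₋)`, `t ≠ 0`; a separating test endomorphism splits `t = t₊ + t₋`
inside `N¹`; `E±` are lines (`finrank_weilClassesPlus_eq_one`), so one of them lies in `N¹`; `N¹`
is spanned by rational classes (`supportedClasses_eq_span_isRationalClass`), hence stable under
complex conjugation, which swaps `E₊` and `E₋`. Why it might fail: only through the typing — it is
false without `0 < x` (for `x = y = 0` the test map is constant) and would need both signs visible
if conjugation were unavailable; as stated it is a theorem. [cite: vanGeemen1994HodgeAV, 4.9–4.11 and Lemma 5.2]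
[cite: GrothendieckTopology1969, §1] [cite: GortzWedhorn2023, Prop. 27.187] -/
theorem stub_weilPlane_coniveau_rigidity :
    ∀ (d : ℕ), 0 < d → ∀ (A : AbelianVariety ℂ) (φ : A ⟶ A), A.dim = 2 * 3 →
      IsSmoothProjective (2 * 3) A.X → φ ≫ φ = -(d • 𝟙 A) →
      ∀ ⦃D : SchemeOver ℂ⦄ (ι : D ⟶ A.X), IsClosedImmersion ι.left →
        IsEffectiveCartier ι.left.ker →
        ∀ s ∈ classesSupportedOn A.X (support ι) (2 * 3), IsWeilVisible A φ d s →
          weilClassesOf A φ 3 d ≤ supportedClasses A.X (2 * 3) 1 := by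
  sorry

/-- STUB B (THE HEART; open — the route's thesis in sharp form) — **every abelian sixfold of
balanced Weil type carries a Weil-visible class on a nodal theta divisor.** For `d ≥ 1`,
`(A, φ ≫ φ = -d·𝟙)` of dimension `6` with `dim (V₊ ∩ H^{1,0}) = 3` (`V₊ = ker(φ^* - i√d) ⊆ H¹`;
equivalently, by Deligne–Milne Prop. 4.4, the Weil plane consists of `(3,3)`-classes), there are
an ample Cartier divisor `Θ`, a level `k ≥ 2`, a nodal member `ι : D ↪ A` of `|kΘ|` and a class
`s` supported on `D` which is Weil-visible. Intended witnesses: `Θ` symmetric with `K`-hermitian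
class (Rosati = conjugation on `K`), `k = 2` and `D` a hyperplane section of `|2Θ|` tangent to
the Kummer variety (nodes at `±x`), `s` the class of a thimble relation `Σ aᵢδᵢ = ∂Γ` among the
vanishing spheres, certified by `Σ_j c_j⟨C, [k_j]_*C⟩ ≠ 0`; fallback `k ≫ 0`. Status: implied by
HC for Weil sixfolds (Thomas2005Nodes §4: Prop. 2, Kleiman's Thm. 5 and Thm. 6 put a smoothed cycle
`Z`, `[Z] = N₁w + N₂θ³`, inside a nodal `D ∈ |NΘ|`, and `π_W[Z] = N₁w ≠ 0` for suitable `N₂`),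
and implying X1 (this file); never proved for an exceptional class without algebraicity. Why it
might fail: false iff a Weil class on a Weil sixfold has coniveau `0` (¬HC, Weil's 1977
candidates); informatively, the level `k = 2` may carry no `W`-dependent vanishing-sphere relation
and Thomas's `N` is ineffective. [cite: Thomas2005Nodes, Thm. 1 (p. 3), §3 eq. (d) (p. 5), Thm. 5–6 (p. 6)]
[cite: vanGeemen1994HodgeAV, 4.9–4.11] [cite: Schoen1988HodgeWeil, §3] [cite: Deligne1982HodgeCycles, Prop. 4.4] -/
theorem stub_nodalThetaMember_weilVisible :
    ∀ (d : ℕ), 0 < d → ∀ (A : AbelianVariety ℂ) (φ : A ⟶ A), A.dim = 2 * 3 →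
      ∀ hsp : IsSmoothProjective (2 * 3) A.X, φ ≫ φ = -(d • 𝟙 A) →
      Module.finrank ℂ ↥(Module.End.eigenspace (complexBetti.map φ.hom.hom.hom 1).hom
            (Complex.I * (Real.sqrt d : ℂ)) ⊓ hodgeOneZero hsp) = 3 →
      ∃ (Θ : CartierDivisor A.X.left) (k : ℕ) (D : SchemeOver ℂ) (ι : D ⟶ A.X),
        Θ.IsAmple ∧ 2 ≤ k ∧ IsNodalThetaMember A Θ k ι ∧
        ∃ s ∈ classesSupportedOn A.X (support ι) (2 * 3), IsWeilVisible A φ d s := by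
  sorry

/-! ### The composition: STUB A → STUB B → the crux, by name -/

/-- **THE LINE'S COMPOSITION** (kernel-checked, no `sorry`): K-rigidity of coniveau on the Weil
plane (STUB A) and a Weil-visible class on a nodal theta divisor of every balanced Weil sixfold
(STUB B) give `NodalThetaSupport`: for a rational `(3,3)` Weil class `c ≠ 0`, `(A, φ)` is balanced
(Deligne–Milne Prop. 4.4 "only if", `finrank_eq_of_mem_weilClassesOf`), STUB B provides the nodal
member and the visible supported class, STUB A puts the Weil plane, hence `c`, in `N¹H⁶`.
[cite: Thomas2005Nodes, Thm. 1] [cite: Deligne1982HodgeCycles, Prop. 4.4] -/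
theorem NodalThetaSupport_of :
    (∀ (d : ℕ), 0 < d → ∀ (A : AbelianVariety ℂ) (φ : A ⟶ A), A.dim = 2 * 3 →
      IsSmoothProjective (2 * 3) A.X → φ ≫ φ = -(d • 𝟙 A) →
      ∀ ⦃D : SchemeOver ℂ⦄ (ι : D ⟶ A.X), IsClosedImmersion ι.left →
        IsEffectiveCartier ι.left.ker →
        ∀ s ∈ classesSupportedOn A.X (support ι) (2 * 3), IsWeilVisible A φ d s →
          weilClassesOf A φ 3 d ≤ supportedClasses A.X (2 * 3) 1) →
    (∀ (d : ℕ), 0 < d → ∀ (A : AbelianVariety ℂ) (φ : A ⟶ A), A.dim = 2 * 3 →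
      ∀ hsp : IsSmoothProjective (2 * 3) A.X, φ ≫ φ = -(d • 𝟙 A) →
      Module.finrank ℂ ↥(Module.End.eigenspace (complexBetti.map φ.hom.hom.hom 1).hom
            (Complex.I * (Real.sqrt d : ℂ)) ⊓ hodgeOneZero hsp) = 3 →
      ∃ (Θ : CartierDivisor A.X.left) (k : ℕ) (D : SchemeOver ℂ) (ι : D ⟶ A.X),
        Θ.IsAmple ∧ 2 ≤ k ∧ IsNodalThetaMember A Θ k ι ∧
        ∃ s ∈ classesSupportedOn A.X (support ι) (2 * 3), IsWeilVisible A φ d s) →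
    Summit.HodgeConjecture.HodgeConjecture.Theses.NodalThetaWeil.NodalThetaSupport := by
  intro hA hB d hd A φ hdim hsp hφ c _hr hh hw
  -- `c` lies in the Weil plane `E₊ ⊔ E₋`
  have hcW : c ∈ weilClassesOf A φ 3 d := mem_weilClassesOf_iff.mpr hw
  by_cases hc : c = 0
  · rw [hc]
    exact Submodule.zero_mem _
  -- a non-zero `(3,3)` Weil class forces balanced Weil type (Deligne–Milne 4.4, only if)
  have hbal := finrank_eq_of_mem_weilClassesOf (m := 3) (by norm_num) hdim hd hφ hcW hc hh
  obtain ⟨Θ, k, D, ι, -, -, ⟨m, -, hnod, hI, -⟩, s, hs, hvis⟩ := hB d hd A φ hdim hsp hφ hbal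
  exact hA d hd A φ hdim hsp hφ ι hnod.isClosedImmersion hI s hs hvis hcW

/-- **The crux, closed modulo exactly the two registered stubs.** -/
theorem NodalThetaSupport_of_stubs :
    Summit.HodgeConjecture.HodgeConjecture.Theses.NodalThetaWeil.NodalThetaSupport :=
  NodalThetaSupport_of stub_weilPlane_coniveau_rigidity stub_nodalThetaMember_weilVisible

/-! ### Sanity: the visibility predicate is inhabited in kind -/

/-- A non-zero class of the Weil plane is Weil-visible (`x = 1`, `y = 0`, `p = 1`). [folklore] -/
theorem isWeilVisible_of_mem {A : AbelianVariety ℂ} {φ : A ⟶ A} {d : ℕ}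
    {s : complexBetti A.X (2 * 3)} (hs : s ∈ weilClassesOf A φ 3 d) (hs0 : s ≠ 0) :
    IsWeilVisible A φ d s := by
  refine ⟨1, 0, 1, Nat.one_pos, ?_, ?_⟩
  · simpa using hs
  · simpa using hs0

end Summit.HodgeConjecture.HodgeConjecture.Cruxes.NodalThetaSupport.Birth

end
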